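import Summits.Ventures.YMGap.RobustBall.KernelClusteringBall
import Summits.Ventures.YMGap.RobustBall.OneStateBoundary
import Summits.Ventures.YMGap.RobustBall.BoundaryDecayTorus
import Summits.Ventures.YMGap.Thresholds.PlaquetteSusceptibility
import Mathlib.Analysis.Normed.Group.Tannery
import HarnessLib

/-!
# Venture YMGap, track ROBUST-BALL — C-KMIX step 4: THE FINITE-VOLUME PLAQUETTE SUSCEPTIBILITY WITH ARBITRARY BOUNDARY FIELDS
# CONVERGES TO THE INFINITE-VOLUME SUSCEPTIBILITY (`SU(2)` on `ℤ⁴`, `0 ≤ β_W ≤ 1/12`)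

HONEST FRAMING. WHAT THIS IS: a venture file (cell `pub-ymgap`, track Y2 ROBUST-BALL, seat ds-3, theorems only), the thermodynamic-limit
companion of `KernelClusteringBall.lean` (C-KMIX): for `SU(2)` lattice Yang–Mills on `ℤ⁴` at `0 ≤ β_W ≤ 1/12` (tree coupling `β_W/2`), the
unique DLR state `μ`, EVERY sequence of finite link volumes `Λ_n` exhausting `ℤ⁴` (every finite set eventually inside) and EVERY sequence of
boundary fields `η_n`:

  `Σ_q cov_{γ_{Λ_n}(·|η_n)}(W_p, W_q)  →  Σ_q cov_μ(W_p, W_q)`   for every plaquette `p`   (`su2_wilson_kernel_susceptibility_tendsto`),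

the sums over all plaquettes `q` of `ℤ⁴`, absolutely convergent: the finite-volume plaquette susceptibility measured with ANY boundary
condition converges to the infinite-volume one. MECHANISM: termwise convergence from the cell's boundary-limit theorem
(`OneStateBoundary.boundaryLimit_of_massGapAt`: `γ_{Λ_n}(F|η_n) → μ(F)` for continuous bounded `F`, here `W_p`, `W_q`, `W_pW_q`),
domination UNIFORM IN `(Λ, η)` by the kernel clustering of `KernelClusteringBall.su2_wilson_kernel_clustering_upTo_oneTwelfth` through
the tree's `abs_cov_zdPlaquetteObs_le_of_decay` and rb-p1's `ℓ¹` lattice sum, and Tannery's theorem (Mathlib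
`tendsto_tsum_of_dominated_convergence`).
WHAT THIS IS NOT: the Wilson point only (`β_W ≤ 1/12`, single-link door; the termwise limit alone holds on the whole star window);
lattice strong coupling; nothing about the continuum limit or the Clay problem.

References: B. Simon, *The Statistical Mechanics of Lattice Gases* I (1993), §II.12, §III.2 (boundary conditions and the thermodynamic
limit); the tree's `KernelClusteringBall.lean`, `OneStateBoundary.lean`, `PlaquetteSusceptibility.lean`.
-/

noncomputable section

open MeasureTheory Filter Function ProbabilityTheory Real Topology
open scoped NNReal
open Literature.Probability.LatticeModels
open Literature.MathematicalPhysics.QuantumLattice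
open Literature.MathematicalPhysics.QuantumFieldTheory hiding ZdEdge Site
open Summit.Ventures.YMGap.PlaquetteSusceptibility (exp_neg_latticeNorm_le_pow)

namespace Summit.Ventures.YMGap.RobustBall

namespace KernelSusceptibilityLimit

/-- ★★ **THE FINITE-VOLUME SUSCEPTIBILITY WITH ARBITRARY BOUNDARY FIELDS CONVERGES TO THE INFINITE-VOLUME SUSCEPTIBILITY**
(`SU(2)`, `ℤ⁴`, `0 ≤ β_W ≤ 1/12`, tree coupling `β_W/2`): the DLR states form a singleton `{μ}`, and for every exhausting sequence of finite
link volumes `Λ_n` (every finite link set is eventually contained in `Λ_n`), every sequence of boundary fields `η_n` and every plaquette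
`p = (x; i<j)`: `Σ_q cov_{γ_{Λ_n}(·|η_n)}(W_p, W_q) → Σ_q cov_μ(W_p, W_q)` (sums over all plaquettes of `ℤ⁴`). [folklore] -/
theorem su2_wilson_kernel_susceptibility_tendsto {βW : ℝ} (h0 : 0 ≤ βW) (h : βW ≤ 1 / 12) :
    ∃ μ : Measure (LGConfig 4 (Matrix.specialUnitaryGroup (Fin 2) ℂ)),
      ymGibbsMeasures (d := 4) (fundamentalRep (Fin 2)) (βW / 2) = {μ} ∧
      ∀ (Λs : ℕ → Finset (ZdEdge 4)), (∀ Δ : Finset (ZdEdge 4), ∀ᶠ n in atTop, Δ ⊆ Λs n) →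
      ∀ (ηs : ℕ → LGConfig 4 (Matrix.specialUnitaryGroup (Fin 2) ℂ)) (p : ZdPlaquette 4),
        Tendsto (fun n => ∑' q : ZdPlaquette 4,
            cov[zdPlaquetteObs (fundamentalRep (Fin 2)) p.1 p.2.1.1 p.2.1.2,
              zdPlaquetteObs (fundamentalRep (Fin 2)) q.1 q.2.1.1 q.2.1.2;
              ymSpecification (d := 4) (fundamentalRep (Fin 2)) (βW / 2) (Λs n) (ηs n)]) atTop
          (𝓝 (∑' q : ZdPlaquette 4, cov[zdPlaquetteObs (fundamentalRep (Fin 2)) p.1 p.2.1.1 p.2.1.2,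
              zdPlaquetteObs (fundamentalRep (Fin 2)) q.1 q.2.1.1 q.2.1.2; μ])) := by
  classical
  -- the unique state and the boundary-limit theorem (star window ⊇ the Wilson point)
  have hβ : |βW / 4| ≤ 9 / 100 := by rw [abs_of_nonneg (by linarith)]; linarith
  obtain ⟨μ, hG, hlim⟩ := boundaryLimit_of_massGapAt (d := 4) (ImprovedThresholdStar.su2_massGapAt_of_abs_le hβ)
  have e2 : (((2 : ℕ) : ℝ) * (βW / 4) : ℝ) = βW / 2 := by push_cast; ring
  rw [e2] at hG hlim
  have hμ : μ ∈ ymGibbsMeasures (d := 4) (fundamentalRep (Fin 2)) (βW / 2) := by rw [hG]; exact Set.mem_singleton μ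
  have hμG : IsGibbsMeasure (ymSpecification (d := 4) (fundamentalRep (Fin 2)) (βW / 2)) μ := hμ
  haveI := hμG.isProbabilityMeasure
  refine ⟨μ, hG, fun Λs hcof ηs p => ?_⟩
  obtain ⟨hF, -⟩ := hlim Λs hcof
  set γ := ymSpecification (d := 4) (fundamentalRep (Fin 2)) (βW / 2) with hγdef
  haveI hγprob : ∀ Λ η, IsProbabilityMeasure (γ Λ η) := fun Λ η =>
    isProbabilityMeasure_ymSpecification _ (continuous_fundamentalRep (Fin 2)) _ Λ η
  set W : ZdPlaquette 4 → LGConfig 4 (Matrix.specialUnitaryGroup (Fin 2) ℂ) → ℝ :=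
    fun r => zdPlaquetteObs (fundamentalRep (Fin 2)) r.1 r.2.1.1 r.2.1.2 with hW
  -- plaquette observables: continuous, bounded by one, in `L²` of every probability measure
  have hWc : ∀ r : ZdPlaquette 4, Continuous (W r) := fun r =>
    continuous_of_isLipschitzCylinder (isLipschitzCylinder_zdPlaquetteObs (N := 2) r.1 r.2.2)
  have hWb : ∀ r : ZdPlaquette 4, ∀ U, |W r U| ≤ 1 := fun r U =>
    abs_zdPlaquetteObs_le fundamentalRep_mem_unitaryGroup r.1 r.2.1.1 r.2.1.2 U
  have hWmem : ∀ (r : ZdPlaquette 4) (ν : Measure (LGConfig 4 (Matrix.specialUnitaryGroup (Fin 2) ℂ)))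
      [IsProbabilityMeasure ν], MemLp (W r) 2 ν := fun r ν _ =>
    memLp_of_bounded (a := -1) (b := 1) (ae_of_all _ fun U => by simp only [Set.mem_Icc]; exact abs_le.1 (hWb r U))
      (hWc r).measurable.aestronglyMeasurable 2
  -- termwise convergence: `cov = ∫ W_p W_q − ∫ W_p ∫ W_q`, each integral converges by the boundary-limit theorem
  have hterm : ∀ q : ZdPlaquette 4, Tendsto (fun n => cov[W p, W q; γ (Λs n) (ηs n)]) atTop (𝓝 (cov[W p, W q; μ])) := by
    intro q
    have h1 := hF ηs (fun U => W p U * W q U) ((hWc p).mul (hWc q))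
      ⟨1, fun U => by rw [abs_mul]; exact mul_le_one₀ (hWb p U) (abs_nonneg _) (hWb q U)⟩
    have h2 := hF ηs (W p) (hWc p) ⟨1, hWb p⟩
    have h3 := hF ηs (W q) (hWc q) ⟨1, hWb q⟩
    have hcovn : ∀ n, cov[W p, W q; γ (Λs n) (ηs n)] =
        (∫ U, W p U * W q U ∂(γ (Λs n) (ηs n))) - (∫ U, W p U ∂(γ (Λs n) (ηs n))) * ∫ U, W q U ∂(γ (Λs n) (ηs n)) :=
      fun n => covariance_eq_sub (hWmem p _) (hWmem q _)
    have hcovμ : cov[W p, W q; μ] = (∫ U, W p U * W q U ∂μ) - (∫ U, W p U ∂μ) * ∫ U, W q U ∂μ :=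
      covariance_eq_sub (hWmem p _) (hWmem q _)
    simp_rw [hcovn, hcovμ]
    exact h1.sub (h2.mul h3)
  -- uniform domination from the kernel clustering at the Wilson point (clause shape, supports of size `≤ 4`)
  set c : ℝ := Real.log 2 with hc
  have hc0 : 0 < c := Real.log_pos (by norm_num)
  set C' : ℝ := max (max (16 * 32) 0 * Real.exp (2 * c) *
      (((4 * (2 : ℝ≥0) ^ 3 : ℝ≥0) : ℝ) * ((4 * (2 : ℝ≥0) ^ 3 : ℝ≥0) : ℝ) + 1)) (4 * Real.exp (2 * c)) with hC'
  have hC'0 : 0 ≤ C' := le_max_of_le_right (by positivity)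
  have h4 : (0 : ℝ) < ((4 : ℕ) : ℝ) := by norm_num
  set r : ℝ := exp (-(c / Real.sqrt ((4 : ℕ) : ℝ) / ((4 : ℕ) : ℝ))) with hr
  have hr0 : 0 ≤ r := (exp_pos _).le
  have hr1 : r < 1 := Real.exp_lt_one_iff.2 (neg_neg_of_pos (div_pos (div_pos hc0 (Real.sqrt_pos.2 h4)) h4))
  have hbound : ∀ (Λ : Finset (ZdEdge 4)) (η : LGConfig 4 (Matrix.specialUnitaryGroup (Fin 2) ℂ)) (q : ZdPlaquette 4),
      |cov[W p, W q; γ Λ η]| ≤ C' * r ^ l1 (p.1 - q.1) := by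
    intro Λ η q
    have hcl : ∀ (F₁ F₂ : LGConfig 4 (Matrix.specialUnitaryGroup (Fin 2) ℂ) → ℝ) (Λ₁ Λ₂ : Finset (ZdEdge 4)) (K₁ K₂ : ℝ≥0),
        Λ₁.card ≤ 4 → Λ₂.card ≤ 4 → Disjoint Λ₁ Λ₂ →
        IsLipschitzCylinder (fundamentalRep (Fin 2)) F₁ Λ₁ K₁ → IsLipschitzCylinder (fundamentalRep (Fin 2)) F₂ Λ₂ K₂ →
          |cov[F₁, F₂; γ Λ η]| ≤ 16 * 32 * Real.exp (-c * setDistEdges Λ₁ Λ₂) *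
            ((K₁ : ℝ) * K₂ + Real.sqrt (∫ U, F₁ U ^ 2 ∂(γ Λ η)) * Real.sqrt (∫ U, F₂ U ^ 2 ∂(γ Λ η))) := by
      intro F₁ F₂ Λ₁ Λ₂ K₁ K₂ h₁ h₂ _ hF₁ hF₂
      have hk := su2_wilson_kernel_clustering_upTo_oneTwelfth h0 h Λ η hF₁ hF₂
      have hn₁ : (Λ₁.card : ℝ) ≤ 4 := by exact_mod_cast h₁
      have hn₂ : (Λ₂.card : ℝ) ≤ 4 := by exact_mod_cast h₂
      have hL : (0 : ℝ) ≤ Real.sqrt (∫ U, F₁ U ^ 2 ∂(γ Λ η)) * Real.sqrt (∫ U, F₂ U ^ 2 ∂(γ Λ η)) := by positivity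
      refine hk.trans ?_
      calc 32 * (Λ₁.card : ℝ) * Λ₂.card * ((K₁ : ℝ) * K₂) * exp (-Real.log 2 * setDistEdges Λ₁ Λ₂)
          ≤ 32 * 4 * 4 * ((K₁ : ℝ) * K₂ + Real.sqrt (∫ U, F₁ U ^ 2 ∂(γ Λ η)) * Real.sqrt (∫ U, F₂ U ^ 2 ∂(γ Λ η))) *
              exp (-c * setDistEdges Λ₁ Λ₂) := by
            rw [hc]; gcongr; exact le_add_of_nonneg_right hL
        _ = 16 * 32 * Real.exp (-c * setDistEdges Λ₁ Λ₂) *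
            ((K₁ : ℝ) * K₂ + Real.sqrt (∫ U, F₁ U ^ 2 ∂(γ Λ η)) * Real.sqrt (∫ U, F₂ U ^ 2 ∂(γ Λ η))) := by ring
    have hdec := abs_cov_zdPlaquetteObs_le_of_decay (μ := γ Λ η) (N := 2) (by norm_num) hc0 hcl p.1 q.1 p.2.2 q.2.2
    refine hdec.trans (mul_le_mul_of_nonneg_left ?_ hC'0)
    have := exp_neg_latticeNorm_le_pow (d := 4) (by norm_num) (div_pos hc0 (Real.sqrt_pos.2 h4)).le (p.1 - q.1)
    simpa only [hr, neg_mul] using this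
  have hsumb : Summable fun q : ZdPlaquette 4 => C' * r ^ l1 (p.1 - q.1) := (summable_and_tsum_row_le (d := 4) hC'0 hr0 hr1 p).1
  -- Tannery
  exact tendsto_tsum_of_dominated_convergence hsumb hterm
    (Eventually.of_forall fun n q => by rw [Real.norm_eq_abs]; exact hbound (Λs n) (ηs n) q)

end KernelSusceptibilityLimit

end Summit.Ventures.YMGap.RobustBall

end
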